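import Mathlib
import HarnessLib
import Summits.Ventures.LatticeQCDFlow.Scaling.AutoregressiveGaugeStepKLLogFloor
import Summits.Ventures.LatticeQCDFlow.Scaling.AutoregressiveGaugeKLExtensiveStepKL
import Summits.Ventures.LatticeQCDFlow.Scaling.AutoregressiveGaugePlaquetteBallMass

/-!
# LatticeQCDFlow / Scaling — THE LOGARITHMIC VOLUME LAW WITH AN ARBITRARY TWO-LEVEL WEIGHT: the per-link
# rate `u·log(u/Haar B) + (1 − u)·log(1 − u) = u·log(1/Haar B) − h(u)` for every plaquette-mass floor
# `u ≤ π_β{U_p ∈ B}` — the Chebyshev factor and the `log 2` of the half-weight law both removed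

HONEST FRAMING: exact (Metropolis-corrected) sampling algorithms for lattice gauge theory;
figures of merit are autocorrelation/cost numbers at stated couplings and volumes; no
continuum-physics claim.

Venture `LatticeQCDFlow` (cell pub-lqcd), topic `Scaling`, FANOUT row 30 (lean-1, GEN-22) — OUR WORK on
THEORY-2.md §4 row C5.  `Scaling/AutoregressiveGaugeKLExtensiveAllPlanesLog` instantiated the volume law
with the HALF-WEIGHT Gibbs floor `π_β(B)·log(1/Haar B) − log 2` of
`Scaling/AutoregressiveGaugeStepKLLogFloor`; with the Chebyshev mass `π_β(B_ε) ≥ ½` this costs a factor `½`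
in front of the logarithm (the lineage's explicit `SU(2)` rate `¾·log β` against the expected `(3/2)·log β`).
Here the GENERAL-WEIGHT engine `wilson_condInfo_ge_ballMass_mul_log_of_weight` (weight `0 < a < 1`) is
carried through the endpoint-blind step and the volume law, and the weight is then set equal to a mass floor
`u ≤ π_β{U_p ∈ B}` (`½ ≤ u < 1`): the per-link rate becomes the binary relative entropy
`u·log(u/Haar B) + (1 − u)·log(1 − u) = u·log(1/Haar B) − h(u)` (`h` the binary entropy `≤ log 2`), whose
prefactor `u` and defect `h(u)` tend to `1` and `0` as the plaquette concentrates — the logarithm now comes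
with its full coefficient.

## What is proved (all [ours]; continuous `ρ`, `L ≥ 2`, any real `β`; `B ⊆ G` measurable, `Haar(B) > 0`;
`0 < a < 1`; squeezed normalised conditionals; `Y_p = ∫𝟙_B(U_p)F dπ`, `Z = ∫F dπ`)

* §0 **`wilson_stepKL_ge_ballMass_mul_log_of_weight`** — `q` not reading the off-`p` context `s`, blind to
  the other links at an endpoint of `e ∈ p`:
  `log(a/Haar B)·Y_p + log(1 − a)·(Z − Y_p) ≤ ∫ F·log(A_sF/(q·A_{insert e s}F)) dπ = Z·κ_e`;
  **`wilson_stepKL_ge_floor_mul_of_ballLogWeight`** — the same as `m·Z ≤ …` for every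
  `m ≤ (Y_p/Z)·log(a/Haar B) + (1 − Y_p/Z)·log(1 − a)`.
* §1 **`wilson_kl_arHybrid_ge_dim_mul_card_site_mul_ballLogWeight`** (`d ≥ 2`, `l` a duplicate-free order
  of ALL links, every `q_e` blind at an endpoint `Y e`; `0 ≤ m ≤` the §0 bound at every plaquette):
  `(d·#sites/4)·m ≤ KL(e^{−βS_W}/Z ‖ H_l)`; **`wilson_tauInt_sign_ge_exp_ballLogWeight`**,
  **`wilson_invKish_ge_exp_ballLogWeight`**.
* §2 **`wilson_kl_arHybrid_ge_dim_mul_card_site_mul_ballLog_of_mass`** — for a common mass floor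
  `½ ≤ u < 1`, `u ≤ Y_p/Z` at every plaquette, and `0 ≤ u·log(u/Haar B) + (1 − u)·log(1 − u)`:
  `(d·#sites/4)·(u·log(u/Haar B) + (1 − u)·log(1 − u)) ≤ KL`; **`wilson_tauInt_sign_ge_exp_ballLog_of_mass`**.
* §3 **`wilson_kl_arHybrid_ge_dim_mul_card_site_mul_ballLog_of_floor_weight`** (unitary `ρ`, `N ≥ 1`,
  `ε > 0`, `B = B_ε = {‖ρ(g) − 1‖ ≤ ε}`) — with `u = 1 − 2N(1 − w)/ε² ∈ [½, 1)` from a common plaquette floor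
  `w ≤ ⟨(1/N)Re tr U_p⟩_β` by Chebyshev: the same law; **`wilson_tauInt_sign_ge_exp_ballLog_of_floor_weight`**.

READING (value-free): choosing `ε² = 2N(1 − w)·t` gives `u = 1 − 1/t`; as `t` grows slowly with the
coupling the rate is `(1 − o(1))·log(1/φ_ρ(ε))`, i.e. the full small-ball surprisal per counted link.
NOT CLAIMED: explicit small-ball masses (group inputs, separate files); conditioners reading both
endpoints.  No `def`, no `sorry`, nothing cited as a fact beyond the tree.
-/

noncomputable section

namespace Summit.Ventures.LatticeQCDFlow.Theory2.Autoregressive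

open MeasureTheory Function Set
open Literature.MathematicalPhysics.QuantumFieldTheory Literature.MathematicalPhysics.QuantumLattice
open Summit.Ventures.LatticeQCDFlow.Exactness Summit.Ventures.LatticeQCDFlow.Scoring
open scoped Matrix Matrix.Norms.Frobenius

section Wilson

variable {d L N : ℕ} {G : Type*} [Group G] [TopologicalSpace G] [IsTopologicalGroup G]
  [CompactSpace G] [SecondCountableTopology G] [MeasurableSpace G] [BorelSpace G] [NeZero L]
  (ρ : G →* Matrix (Fin N) (Fin N) ℂ)

/-! ## §0 The step loss of an endpoint-blind conditioner, general weight -/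

/-- **THE LOGARITHMIC STEP-LOSS FLOOR, GENERAL WEIGHT.**  Continuous `ρ`, `L ≥ 2`, any `β`; plaquette `p`,
`e` any of its links, `s` a set of links off `p`; `q` measurable with `0 < c_q ≤ q ≤ C_q`, normalised in `e`,
not reading the links of `s`, blind to every other link at an endpoint `y` of `e`; `B ⊆ G` measurable,
`Haar(B) > 0`; weight `0 < a < 1`.  Then
`log(a/Haar B)·∫ 𝟙_B(U_p)·F dπ + log(1 − a)·(Z − ∫ 𝟙_B(U_p)·F dπ) ≤ ∫ F·log(A_sF/(q·A_{insert e s}F)) dπ`. [ours] -/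
theorem wilson_stepKL_ge_ballMass_mul_log_of_weight (hρ : Continuous ρ) (hL : 2 ≤ L) (β : ℝ)
    (p : Plaquette d L) {e : Edge d L}
    (he : e ∈ ({(p.1, p.2.1.1), (p.1.shift p.2.1.1, p.2.1.2), (p.1.shift p.2.1.2, p.2.1.1), (p.1, p.2.1.2)} :
      Finset (Edge d L)))
    {s : Finset (Edge d L)}
    (hs : s ⊆ Finset.univ \
      {(p.1, p.2.1.1), (p.1.shift p.2.1.1, p.2.1.2), (p.1.shift p.2.1.2, p.2.1.1), (p.1, p.2.1.2)})
    {B : Set G} (hBm : MeasurableSet B) (hB0 : 0 < (haarProbability G).real B)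
    {a : ℝ} (ha0 : 0 < a) (ha1 : a < 1)
    {q : GaugeConfig d L G → ℝ} (hqm : Measurable q) {cq Cq : ℝ} (hcq : 0 < cq) (hqlo : ∀ U, cq ≤ q U)
    (hqhi : ∀ U, q U ≤ Cq) (hq1 : ∀ U, ∫ v, q (update U e v) ∂(haarProbability G) = 1)
    (hqs : ∀ U V, q (s.piecewise V U) = q U)
    {y : Site d L} (hy : e.1 = y ∨ e.1.shift e.2 = y)
    (hqB : ∀ e' : Edge d L, e'.1 = y ∨ e'.1.shift e'.2 = y → e' ≠ e →
      ∀ (U : GaugeConfig d L G) (v : G), q (update U e' v) = q U) :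
    Real.log (a / (haarProbability G).real B) *
          (∫ U, B.indicator (1 : G → ℝ) (plaquetteHolonomy U p.1 p.2.1.1 p.2.1.2) *
            Real.exp (-β * wilsonAction ρ U) ∂Measure.pi (fun _ : Edge d L => haarProbability G)) +
        Real.log (1 - a) *
          ((∫ U, Real.exp (-β * wilsonAction ρ U) ∂Measure.pi (fun _ : Edge d L => haarProbability G)) -
            ∫ U, B.indicator (1 : G → ℝ) (plaquetteHolonomy U p.1 p.2.1.1 p.2.1.2) *
              Real.exp (-β * wilsonAction ρ U) ∂Measure.pi (fun _ : Edge d L => haarProbability G)) ≤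
      ∫ U, Real.exp (-β * wilsonAction ρ U) *
          Real.log (coordAvg (haarProbability G) s (fun V : GaugeConfig d L G => Real.exp (-β * wilsonAction ρ V)) U /
            (q U * coordAvg (haarProbability G) (insert e s)
              (fun V : GaugeConfig d L G => Real.exp (-β * wilsonAction ρ V)) U))
        ∂Measure.pi (fun _ : Edge d L => haarProbability G) := by
  classical
  haveI : Fact (1 < L) := ⟨hL⟩
  set μ := haarProbability G with hμ
  set π := Measure.pi (fun _ : Edge d L => μ) with hπ
  set F : GaugeConfig d L G → ℝ := fun V => Real.exp (-β * wilsonAction ρ V) with hF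
  set Nf := coordAvg μ s F with hN'
  set M := coordAvg μ (insert e s) F with hM
  obtain ⟨hFm, Bd, hFlo, hFhi⟩ := wilsonWeight_props (d := d) (L := L) ρ hρ β
  have hcF : 0 < Real.exp (-(|β| * Bd)) := Real.exp_pos _
  have hF0 : ∀ U, 0 ≤ F U := fun U => (Real.exp_pos _).le
  have hFb : ∀ U, |F U| ≤ Real.exp (|β| * Bd) := fun U => by
    simp only [hF]; rw [abs_of_pos (Real.exp_pos _)]; exact hFhi U
  have hNf := fun U => coordAvg_pos_of_le μ s hFm hcF hFlo hFhi U
  have hMf := fun U => coordAvg_pos_of_le μ (insert e s) hFm hcF hFlo hFhi U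
  have hNm : Measurable Nf := measurable_coordAvg _ s hFm
  have hMm : Measurable M := measurable_coordAvg _ (insert e s) hFm
  have hq0 : ∀ U, 0 < q U := fun U => hcq.trans_le (hqlo U)
  have hsplit : ∀ U, F U * Real.log (Nf U / (q U * M U)) =
      F U * Real.log (Nf U / M U) - F U * Real.log (q U) := fun U => by
    rw [show Nf U / (q U * M U) = (Nf U / M U) / q U by field_simp,
      Real.log_div (div_pos (hNf U).1 (hMf U).1).ne' (hq0 U).ne']
    ring
  set b : ℝ := |β| * Bd with hb
  have hlogNM : ∀ U, |Real.log (Nf U / M U)| ≤ 2 * b := fun U => by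
    rw [Real.log_div (hNf U).1.ne' (hMf U).1.ne']
    have h1 : -b ≤ Real.log (Nf U) := by
      have := Real.log_le_log hcF (hNf U).2.1; rwa [Real.log_exp] at this
    have h2 : Real.log (Nf U) ≤ b := by
      have := Real.log_le_log (hNf U).1 (hNf U).2.2; rwa [Real.log_exp] at this
    have h3 : -b ≤ Real.log (M U) := by
      have := Real.log_le_log hcF (hMf U).2.1; rwa [Real.log_exp] at this
    have h4 : Real.log (M U) ≤ b := by
      have := Real.log_le_log (hMf U).1 (hMf U).2.2; rwa [Real.log_exp] at this
    rw [abs_le]; constructor <;> linarith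
  have hlogq : ∀ U, |Real.log (q U)| ≤ |Real.log cq| + |Real.log Cq| := fun U => abs_le.2
    ⟨by linarith [Real.log_le_log hcq (hqlo U), neg_abs_le (Real.log cq), abs_nonneg (Real.log Cq)],
     by linarith [Real.log_le_log (hq0 U) (hqhi U), le_abs_self (Real.log Cq), abs_nonneg (Real.log cq)]⟩
  have hi1 : Integrable (fun U => F U * Real.log (Nf U / M U)) π :=
    integrable_pi_of_abs_le μ (hFm.mul (Real.measurable_log.comp (hNm.div hMm)))
      (C := Real.exp (|β| * Bd) * (2 * b))
      (fun U => by rw [abs_mul]; exact mul_le_mul (hFb U) (hlogNM U) (abs_nonneg _) (Real.exp_pos _).le)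
  have hi2 : Integrable (fun U => F U * Real.log (q U)) π :=
    integrable_pi_of_abs_le μ (hFm.mul (Real.measurable_log.comp hqm))
      (C := Real.exp (|β| * Bd) * (|Real.log cq| + |Real.log Cq|))
      (fun U => by rw [abs_mul]; exact mul_le_mul (hFb U) (hlogq U) (abs_nonneg _) (Real.exp_pos _).le)
  -- the blind conditioner is no better than flat in expected log-likelihood
  have hloop : e.1 ≠ e.1.shift e.2 := fun h => (site_shift_ne hL e.1 e.2) h.symm
  have hV : ∫ U, F U * Real.log (q U) ∂π ≤ 0 :=
    integral_weight_mul_log_nonpos_of_vertexBlind s (isGaugeInvariant_wilsonWeightFun ρ β) hFm hF0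
      ⟨_, hFhi⟩ hy hloop hqm ⟨cq, hcq, hqlo⟩ ⟨Cq, hqhi⟩ hqB hq1 hqs
  -- the general-weight engine
  have hE := wilson_condInfo_ge_ballMass_mul_log_of_weight (d := d) (L := L) ρ hρ hL β p he hs hBm hB0 ha0 ha1
  have hrw : ∫ U, F U * Real.log (Nf U / (q U * M U)) ∂π =
      ∫ U, F U * Real.log (Nf U / M U) ∂π - ∫ U, F U * Real.log (q U) ∂π := by
    rw [← integral_sub hi1 hi2]
    exact integral_congr_ae (ae_of_all _ hsplit)
  rw [hrw]
  linarith [hE, hV]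

/-- **The general-weight floor in the shape the volume law wants.**  Under the hypotheses of
`wilson_stepKL_ge_ballMass_mul_log_of_weight`, for every
`m ≤ (Y_p/Z)·log(a/Haar B) + (1 − Y_p/Z)·log(1 − a)` (`Y_p = ∫𝟙_B(U_p)F dπ`, `Z = ∫F dπ`):
`m·Z ≤ ∫ F·log(A_sF/(q·A_{insert e s}F)) dπ`. [ours] -/
theorem wilson_stepKL_ge_floor_mul_of_ballLogWeight (hρ : Continuous ρ) (hL : 2 ≤ L) (β : ℝ)
    {B : Set G} (hBm : MeasurableSet B) (hB0 : 0 < (haarProbability G).real B)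
    {a : ℝ} (ha0 : 0 < a) (ha1 : a < 1)
    (p : Plaquette d L) {m : ℝ}
    (hmp : m ≤ (∫ U, B.indicator (1 : G → ℝ) (plaquetteHolonomy U p.1 p.2.1.1 p.2.1.2) *
            Real.exp (-β * wilsonAction ρ U) ∂Measure.pi (fun _ : Edge d L => haarProbability G)) /
          (∫ W, Real.exp (-β * wilsonAction ρ W) ∂Measure.pi (fun _ : Edge d L => haarProbability G)) *
          Real.log (a / (haarProbability G).real B) +
        (1 - (∫ U, B.indicator (1 : G → ℝ) (plaquetteHolonomy U p.1 p.2.1.1 p.2.1.2) *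
            Real.exp (-β * wilsonAction ρ U) ∂Measure.pi (fun _ : Edge d L => haarProbability G)) /
          (∫ W, Real.exp (-β * wilsonAction ρ W) ∂Measure.pi (fun _ : Edge d L => haarProbability G))) *
          Real.log (1 - a))
    {e : Edge d L}
    (he : e ∈ ({(p.1, p.2.1.1), (p.1.shift p.2.1.1, p.2.1.2), (p.1.shift p.2.1.2, p.2.1.1), (p.1, p.2.1.2)} :
      Finset (Edge d L)))
    {s : Finset (Edge d L)}
    (hs : s ⊆ Finset.univ \
      {(p.1, p.2.1.1), (p.1.shift p.2.1.1, p.2.1.2), (p.1.shift p.2.1.2, p.2.1.1), (p.1, p.2.1.2)})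
    {q : GaugeConfig d L G → ℝ} (hqm : Measurable q) {cq Cq : ℝ} (hcq : 0 < cq) (hqlo : ∀ U, cq ≤ q U)
    (hqhi : ∀ U, q U ≤ Cq) (hq1 : ∀ U, ∫ v, q (update U e v) ∂(haarProbability G) = 1)
    (hqs : ∀ U V, q (s.piecewise V U) = q U)
    {y : Site d L} (hy : e.1 = y ∨ e.1.shift e.2 = y)
    (hqB : ∀ e' : Edge d L, e'.1 = y ∨ e'.1.shift e'.2 = y → e' ≠ e →
      ∀ (U : GaugeConfig d L G) (v : G), q (update U e' v) = q U) :
    m * (∫ W, Real.exp (-β * wilsonAction ρ W) ∂Measure.pi (fun _ : Edge d L => haarProbability G)) ≤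
      ∫ U, Real.exp (-β * wilsonAction ρ U) *
          Real.log (coordAvg (haarProbability G) s (fun V : GaugeConfig d L G => Real.exp (-β * wilsonAction ρ V)) U /
            (q U * coordAvg (haarProbability G) (insert e s)
              (fun V : GaugeConfig d L G => Real.exp (-β * wilsonAction ρ V)) U))
        ∂Measure.pi (fun _ : Edge d L => haarProbability G) := by
  set π := Measure.pi (fun _ : Edge d L => haarProbability G) with hπ
  set Z : ℝ := ∫ W, Real.exp (-β * wilsonAction ρ W) ∂π with hZ
  set Y : ℝ := ∫ U, B.indicator (1 : G → ℝ) (plaquetteHolonomy U p.1 p.2.1.1 p.2.1.2) *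
      Real.exp (-β * wilsonAction ρ U) ∂π with hY
  have hZpos : 0 < Z :=
    integral_exp_pos (Literature.Probability.LatticeModels.integrable_of_continuous_compactSpace _
      (Real.continuous_exp.comp (continuous_const.mul (continuous_wilsonAction ρ hρ))))
  have hstep := wilson_stepKL_ge_ballMass_mul_log_of_weight (d := d) (L := L) ρ hρ hL β p he hs hBm hB0 ha0
    ha1 hqm hcq hqlo hqhi hq1 hqs hy hqB
  -- `m·Z ≤ ((Y/Z)·log(a/Haar B) + (1 − Y/Z)·log(1 − a))·Z = log(a/Haar B)·Y + log(1 − a)·(Z − Y)`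
  have h1 : m * Z ≤ (Y / Z * Real.log (a / (haarProbability G).real B) + (1 - Y / Z) * Real.log (1 - a)) * Z :=
    mul_le_mul_of_nonneg_right hmp hZpos.le
  have e1 : (Y / Z * Real.log (a / (haarProbability G).real B) + (1 - Y / Z) * Real.log (1 - a)) * Z =
      Real.log (a / (haarProbability G).real B) * Y + Real.log (1 - a) * (Z - Y) := by
    field_simp
  rw [e1] at h1
  exact h1.trans hstep

/-! ## §1 The volume law with the general-weight logarithmic rate -/

/-- **THE VOLUME LAW FOR THE TRAINING LOSS, GENERAL-WEIGHT LOGARITHMIC RATE.**  `d ≥ 2`, `L ≥ 2`,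
continuous `ρ`, any `β`; `B ⊆ G` measurable with `Haar(B) > 0`; `0 < a < 1`;
`0 ≤ m ≤ (Y_p/Z)·log(a/Haar B) + (1 − Y_p/Z)·log(1 − a)` for every plaquette `p`; squeezed normalised
conditionals, `l` a duplicate-free list of ALL links (any order), `q_a` not reading later links, every `q_e`
blind to the other links at an endpoint `Y e` of `e`.  Then `(d·#sites/4)·m ≤ KL(e^{−βS_W}/Z ‖ H_l)`. [ours] -/
theorem wilson_kl_arHybrid_ge_dim_mul_card_site_mul_ballLogWeight (hd : 2 ≤ d) (hρ : Continuous ρ)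
    (hL : 2 ≤ L) (β : ℝ) {B : Set G} (hBm : MeasurableSet B) (hB0 : 0 < (haarProbability G).real B)
    {a : ℝ} (ha0 : 0 < a) (ha1 : a < 1) {m : ℝ} (hm0 : 0 ≤ m)
    (hmB : ∀ p : Plaquette d L, m ≤
        (∫ U, B.indicator (1 : G → ℝ) (plaquetteHolonomy U p.1 p.2.1.1 p.2.1.2) *
            Real.exp (-β * wilsonAction ρ U) ∂Measure.pi (fun _ : Edge d L => haarProbability G)) /
          (∫ W, Real.exp (-β * wilsonAction ρ W) ∂Measure.pi (fun _ : Edge d L => haarProbability G)) *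
          Real.log (a / (haarProbability G).real B) +
        (1 - (∫ U, B.indicator (1 : G → ℝ) (plaquetteHolonomy U p.1 p.2.1.1 p.2.1.2) *
            Real.exp (-β * wilsonAction ρ U) ∂Measure.pi (fun _ : Edge d L => haarProbability G)) /
          (∫ W, Real.exp (-β * wilsonAction ρ W) ∂Measure.pi (fun _ : Edge d L => haarProbability G))) *
          Real.log (1 - a))
    {q : Edge d L → GaugeConfig d L G → ℝ} (hqm : ∀ a, Measurable (q a)) {cq Cq : ℝ} (hcq : 0 < cq)
    (hqlo : ∀ a U, cq ≤ q a U) (hqhi : ∀ a U, q a U ≤ Cq)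
    (hq1 : ∀ a U, ∫ v, q a (update U a v) ∂(haarProbability G) = 1)
    (l : List (Edge d L)) (hl : l.Nodup) (hall : ∀ e : Edge d L, e ∈ l)
    (hpw : l.Pairwise (fun a b => ∀ (U : GaugeConfig d L G) (v : G), q a (update U b v) = q a U))
    (Y : Edge d L → Site d L) (hY : ∀ e : Edge d L, e.1 = Y e ∨ e.1.shift e.2 = Y e)
    (hqB : ∀ e e' : Edge d L, e'.1 = Y e ∨ e'.1.shift e'.2 = Y e → e' ≠ e →
      ∀ (U : GaugeConfig d L G) (v : G), q e (update U e' v) = q e U) :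
    (d : ℝ) * Fintype.card (Site d L) / 4 * m ≤
      ∫ U, Real.exp (-β * wilsonAction ρ U) /
            (∫ W, Real.exp (-β * wilsonAction ρ W) ∂Measure.pi (fun _ : Edge d L => haarProbability G)) *
          Real.log ((Real.exp (-β * wilsonAction ρ U) /
              ∫ W, Real.exp (-β * wilsonAction ρ W) ∂Measure.pi (fun _ : Edge d L => haarProbability G)) /
            ((l.map fun b => q b U).prod *
                coordAvg (haarProbability G) l.toFinset
                  (fun V : GaugeConfig d L G => Real.exp (-β * wilsonAction ρ V)) U /
              ∫ W, Real.exp (-β * wilsonAction ρ W) ∂Measure.pi (fun _ : Edge d L => haarProbability G)))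
        ∂Measure.pi (fun _ : Edge d L => haarProbability G) := by
  exact wilson_kl_arHybrid_ge_dim_mul_card_site_mul_of_stepKL (d := d) (L := L) ρ hd hρ β hqm hcq hqlo hqhi
    hq1 l hl hall hpw hm0 (fun p e he s hs hqs =>
      wilson_stepKL_ge_floor_mul_of_ballLogWeight (d := d) (L := L) ρ hρ hL β hBm hB0 ha0 ha1 p (hmB p) he hs
        (hqm e) hcq (hqlo e) (hqhi e) (hq1 e) hqs (hY e) (hqB e))

/-- **`τ_int(g) ≥ exp((d·#sites/4)·m) − ½`** for every measurable balanced sign observable `g` of the exact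
independence sampler, under the hypotheses of `wilson_kl_arHybrid_ge_dim_mul_card_site_mul_ballLogWeight`.
[ours] -/
theorem wilson_tauInt_sign_ge_exp_ballLogWeight (hd : 2 ≤ d) (hρ : Continuous ρ)
    (hL : 2 ≤ L) (β : ℝ) {B : Set G} (hBm : MeasurableSet B) (hB0 : 0 < (haarProbability G).real B)
    {a : ℝ} (ha0 : 0 < a) (ha1 : a < 1) {m : ℝ} (hm0 : 0 ≤ m)
    (hmB : ∀ p : Plaquette d L, m ≤
        (∫ U, B.indicator (1 : G → ℝ) (plaquetteHolonomy U p.1 p.2.1.1 p.2.1.2) *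
            Real.exp (-β * wilsonAction ρ U) ∂Measure.pi (fun _ : Edge d L => haarProbability G)) /
          (∫ W, Real.exp (-β * wilsonAction ρ W) ∂Measure.pi (fun _ : Edge d L => haarProbability G)) *
          Real.log (a / (haarProbability G).real B) +
        (1 - (∫ U, B.indicator (1 : G → ℝ) (plaquetteHolonomy U p.1 p.2.1.1 p.2.1.2) *
            Real.exp (-β * wilsonAction ρ U) ∂Measure.pi (fun _ : Edge d L => haarProbability G)) /
          (∫ W, Real.exp (-β * wilsonAction ρ W) ∂Measure.pi (fun _ : Edge d L => haarProbability G))) *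
          Real.log (1 - a))
    {q : Edge d L → GaugeConfig d L G → ℝ} (hqm : ∀ a, Measurable (q a)) {cq Cq : ℝ} (hcq : 0 < cq)
    (hqlo : ∀ a U, cq ≤ q a U) (hqhi : ∀ a U, q a U ≤ Cq)
    (hq1 : ∀ a U, ∫ v, q a (update U a v) ∂(haarProbability G) = 1)
    (l : List (Edge d L)) (hl : l.Nodup) (hall : ∀ e : Edge d L, e ∈ l)
    (hpw : l.Pairwise (fun a b => ∀ (U : GaugeConfig d L G) (v : G), q a (update U b v) = q a U))
    (Y : Edge d L → Site d L) (hY : ∀ e : Edge d L, e.1 = Y e ∨ e.1.shift e.2 = Y e)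
    (hqB : ∀ e e' : Edge d L, e'.1 = Y e ∨ e'.1.shift e'.2 = Y e → e' ≠ e →
      ∀ (U : GaugeConfig d L G) (v : G), q e (update U e' v) = q e U)
    {g : GaugeConfig d L G → ℝ} (hgm : Measurable g) (hg1 : ∀ U, g U ^ 2 = 1)
    (hg0 : ∫ U, g U * Real.exp (-β * wilsonAction ρ U) ∂Measure.pi (fun _ : Edge d L => haarProbability G) = 0) :
    Real.exp ((d : ℝ) * Fintype.card (Site d L) / 4 * m) - 1 / 2 ≤
      tauInt (fun k => (∫ U, g U * ((imhOp (Measure.pi fun _ : Edge d L => haarProbability G)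
          (fun V : GaugeConfig d L G => Real.exp (-β * wilsonAction ρ V))
          (fun V : GaugeConfig d L G => (l.map fun b => q b V).prod *
              coordAvg (haarProbability G) l.toFinset
                (fun V' : GaugeConfig d L G => Real.exp (-β * wilsonAction ρ V')) V /
            ∫ W, Real.exp (-β * wilsonAction ρ W) ∂Measure.pi (fun _ : Edge d L => haarProbability G)))^[k]
            g) U * Real.exp (-β * wilsonAction ρ U) ∂Measure.pi (fun _ : Edge d L => haarProbability G)) /
          ∫ U, g U ^ 2 * Real.exp (-β * wilsonAction ρ U) ∂Measure.pi (fun _ : Edge d L => haarProbability G)) := by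
  exact wilson_tauInt_sign_ge_exp_of_stepKL (d := d) (L := L) ρ hd hρ β hqm hcq hqlo hqhi hq1 l hl hall hpw hm0
    (fun p e he s hs hqs =>
      wilson_stepKL_ge_floor_mul_of_ballLogWeight (d := d) (L := L) ρ hρ hL β hBm hB0 ha0 ha1 p (hmB p) he hs
        (hqm e) hcq (hqlo e) (hqhi e) (hq1 e) hqs (hY e) (hqB e)) hgm hg1 hg0

/-- **`1/κ ≥ exp((d·#sites/4)·m)`** — Kish fraction `≤ exp(−(d·#sites/4)·m)`, general weight. [ours] -/
theorem wilson_invKish_ge_exp_ballLogWeight (hd : 2 ≤ d) (hρ : Continuous ρ)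
    (hL : 2 ≤ L) (β : ℝ) {B : Set G} (hBm : MeasurableSet B) (hB0 : 0 < (haarProbability G).real B)
    {a : ℝ} (ha0 : 0 < a) (ha1 : a < 1) {m : ℝ} (hm0 : 0 ≤ m)
    (hmB : ∀ p : Plaquette d L, m ≤
        (∫ U, B.indicator (1 : G → ℝ) (plaquetteHolonomy U p.1 p.2.1.1 p.2.1.2) *
            Real.exp (-β * wilsonAction ρ U) ∂Measure.pi (fun _ : Edge d L => haarProbability G)) /
          (∫ W, Real.exp (-β * wilsonAction ρ W) ∂Measure.pi (fun _ : Edge d L => haarProbability G)) *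
          Real.log (a / (haarProbability G).real B) +
        (1 - (∫ U, B.indicator (1 : G → ℝ) (plaquetteHolonomy U p.1 p.2.1.1 p.2.1.2) *
            Real.exp (-β * wilsonAction ρ U) ∂Measure.pi (fun _ : Edge d L => haarProbability G)) /
          (∫ W, Real.exp (-β * wilsonAction ρ W) ∂Measure.pi (fun _ : Edge d L => haarProbability G))) *
          Real.log (1 - a))
    {q : Edge d L → GaugeConfig d L G → ℝ} (hqm : ∀ a, Measurable (q a)) {cq Cq : ℝ} (hcq : 0 < cq)
    (hqlo : ∀ a U, cq ≤ q a U) (hqhi : ∀ a U, q a U ≤ Cq)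
    (hq1 : ∀ a U, ∫ v, q a (update U a v) ∂(haarProbability G) = 1)
    (l : List (Edge d L)) (hl : l.Nodup) (hall : ∀ e : Edge d L, e ∈ l)
    (hpw : l.Pairwise (fun a b => ∀ (U : GaugeConfig d L G) (v : G), q a (update U b v) = q a U))
    (Y : Edge d L → Site d L) (hY : ∀ e : Edge d L, e.1 = Y e ∨ e.1.shift e.2 = Y e)
    (hqB : ∀ e e' : Edge d L, e'.1 = Y e ∨ e'.1.shift e'.2 = Y e → e' ≠ e →
      ∀ (U : GaugeConfig d L G) (v : G), q e (update U e' v) = q e U) :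
    Real.exp ((d : ℝ) * Fintype.card (Site d L) / 4 * m) ≤
      (∫ U, Real.exp (-β * wilsonAction ρ U) /
            ((l.map fun b => q b U).prod *
                coordAvg (haarProbability G) l.toFinset
                  (fun V : GaugeConfig d L G => Real.exp (-β * wilsonAction ρ V)) U /
              ∫ W, Real.exp (-β * wilsonAction ρ W) ∂Measure.pi (fun _ : Edge d L => haarProbability G)) *
          Real.exp (-β * wilsonAction ρ U) ∂Measure.pi (fun _ : Edge d L => haarProbability G)) /
        (∫ W, Real.exp (-β * wilsonAction ρ W) ∂Measure.pi (fun _ : Edge d L => haarProbability G)) ^ 2 := by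
  exact wilson_invKish_ge_exp_of_stepKL (d := d) (L := L) ρ hd hρ β hqm hcq hqlo hqhi hq1 l hl hall hpw hm0
    (fun p e he s hs hqs =>
      wilson_stepKL_ge_floor_mul_of_ballLogWeight (d := d) (L := L) ρ hρ hL β hBm hB0 ha0 ha1 p (hmB p) he hs
        (hqm e) hcq (hqlo e) (hqhi e) (hq1 e) hqs (hY e) (hqB e))

end Wilson

end Summit.Ventures.LatticeQCDFlow.Theory2.Autoregressive

end
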